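import Literature.NumberTheory.QuadraticFields.BinaryQuadraticFormsRepresentation
import Literature.NumberTheory.QuadraticFields.ReducedFormsNonmaximalProofs
import Mathlib.Data.Nat.Log
import HarnessLib

/-!
# Hallgren 2005 / class numbers under GRH — step Q1b: Gauss reduction as an explicit algorithm
# with a logarithmic number of steps

Topic `Literature/Computability/Cryptography`; proof companion of `HallgrenClassGroup.lean`
(named fact `Hallgren2005_classNumber_qsolvable_of_GRH`). Real definitions (with bodies) and
theorems; no named fact.

The class-number algorithm represents ideal classes by REDUCED forms (Cox, Thm. 2.8), and must
reduce the output of a composition inside a reversible circuit, so reduction must be an explicit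
function with a polynomial (here: logarithmic) number of steps. The tree has the existence and
uniqueness of the reduced representative (`BinQF.exists_properEquiv_isReduced`,
`BinQF.isReduced_unique`, by descent on `a + |b|`); this file supplies the ALGORITHM:

* `normShift`, `normalizeB` — the shift `T^k` bringing `b` into `(−a, a]` (`normalizeB_b_bounds`);
* `NeedsSwap`, `swapS`, `step = (swap if needed) ∘ normalizeB` — one Gauss step, a proper
  equivalence (`properEquiv_step`), fixing reduced forms (`step_eq_self_of_isReduced`);
* **halving** (`step_a_lt_half`): while `a² > |D|`, a step swaps and the new first coefficient is
  `< a/2` (`4ac = b² + |D| ≤ a² + |D| < 2a²`);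
* **tail** (`isReduced_step_step`): once `a² ≤ |D|`, two more steps give a reduced form (the
  normalising shift after the swap is `j ∈ {−1, 0, 1}`, for `|j| ≥ 2` would force `|b| ≥ 3c` and
  `(a − 2c)² + 5c² ≤ 0`; hence the new last coefficient is `≥` the new first one);
* `reduce f = step^[⌊log₂ a⌋ + 4] f` and **correctness**: `properEquiv_reduce`,
  `isReduced_reduce`, `reduce_mem_reducedForms`, and `reduce_eq_iff_properEquiv` (reduced forms are
  unique in a class).

## References

* D. A. Cox, *Primes of the form x² + ny²*, 2nd ed. (2013), §2.A Thm. 2.8 [Cox2013].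
* H. Cohen, *A Course in Computational Algebraic Number Theory*, GTM 138, Algorithm 5.4.2 and the
  analysis of its number of steps [folklore].
* A. M. Childs, W. van Dam, Rev. Mod. Phys. 82 (2010), §5.7 ("unique representatives that can be
  computed efficiently") [ChildsVandam2010].
-/

namespace Literature.Computability.Cryptography.Hallgren2005

namespace Reduction

open Literature.NumberTheory.QuadraticFields.Quadratic
open Literature.NumberTheory.QuadraticFields.Quadratic.BinQF
open Literature.NumberTheory.QuadraticFields.BinaryQuadraticForm (reducedForms mem_reducedForms_of_isPosPrim_of_isReduced)

/-! ### Normalisation of the middle coefficient -/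

/-- The shift `k = ⌊(a − b)/(2a)⌋` with `b + 2ak ∈ (−a, a]`. [cite: Cox2013, §2.A Thm. 2.8 (proof)] -/
def normShift (f : BinQF) : ℤ := (f.a - f.b) / (2 * f.a)

/-- **Normalisation** `f ↦ f·T^k`: `(a, b + 2ak, ak² + bk + c)` with `k = normShift f`, so that the
middle coefficient lies in `(−a, a]`. [cite: Cox2013, §2.A Thm. 2.8 (proof)] -/
def normalizeB (f : BinQF) : BinQF :=
  ⟨f.a, f.b + 2 * f.a * normShift f, f.a * normShift f ^ 2 + f.b * normShift f + f.c⟩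

/-- `normalizeB` does not change `a`. [folklore] -/
@[simp] theorem normalizeB_a (f : BinQF) : (normalizeB f).a = f.a := rfl

/-- `normalizeB f` is `f·T^k`, a proper equivalence. [cite: Cox2013, §2.A] -/
theorem properEquiv_normalizeB (f : BinQF) : f.ProperEquiv (normalizeB f) :=
  f.properEquiv_T (normShift f)

/-- The normalised middle coefficient: `b' = a − ((a − b) mod 2a)`. [folklore] -/
theorem normalizeB_b_eq (f : BinQF) : (normalizeB f).b = f.a - (f.a - f.b) % (2 * f.a) := by
  simp only [normalizeB, normShift]
  rw [Int.emod_def]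
  ring

/-- **`−a < b' ≤ a`** after normalisation (`a > 0`). [cite: Cox2013, §2.A Thm. 2.8 (proof)] -/
theorem normalizeB_b_bounds {f : BinQF} (ha : 0 < f.a) :
    -f.a < (normalizeB f).b ∧ (normalizeB f).b ≤ f.a := by
  rw [normalizeB_b_eq]
  have h0 : 0 ≤ (f.a - f.b) % (2 * f.a) := Int.emod_nonneg _ (by positivity)
  have h2 : (f.a - f.b) % (2 * f.a) < 2 * f.a := Int.emod_lt_of_pos _ (by positivity)
  constructor <;> linarith

/-- A form with `−a < b ≤ a` is not changed by normalisation. [folklore] -/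
theorem normalizeB_eq_self {f : BinQF} (ha : 0 < f.a) (h1 : -f.a < f.b) (h2 : f.b ≤ f.a) :
    normalizeB f = f := by
  have hk : normShift f = 0 := by
    rw [normShift]
    exact Int.ediv_eq_zero_of_lt (by linarith) (by linarith)
  obtain ⟨a, b, c⟩ := f
  simp only [normalizeB, hk]
  ext <;> simp

/-! ### One Gauss step -/

/-- The swap `f ↦ f·S = (c, −b, a)` is needed when `c < a`, or `a = c` with `b < 0`.
[cite: Cox2013, §2.A Thm. 2.8 (proof)] -/
def NeedsSwap (g : BinQF) : Prop := g.c < g.a ∨ (g.a = g.c ∧ g.b < 0)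

/-- `NeedsSwap` is decidable (integer comparisons). [folklore] -/
instance (g : BinQF) : Decidable (NeedsSwap g) := inferInstanceAs (Decidable (_ ∨ _))

/-- The swap `(a, b, c) ↦ (c, −b, a)`. [cite: Cox2013, §2.A] -/
def swapS (g : BinQF) : BinQF := ⟨g.c, -g.b, g.a⟩

/-- **One Gauss step**: normalise, then swap if needed. [cite: Cox2013, §2.A Thm. 2.8 (proof)] -/
def step (f : BinQF) : BinQF :=
  if NeedsSwap (normalizeB f) then swapS (normalizeB f) else normalizeB f

/-- A step is a proper equivalence. [cite: Cox2013, §2.A] -/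
theorem properEquiv_step (f : BinQF) : f.ProperEquiv (step f) := by
  unfold step
  split_ifs with h
  · exact (properEquiv_normalizeB f).trans (normalizeB f).properEquiv_S
  · exact properEquiv_normalizeB f

/-- Iterated steps are proper equivalences. [cite: Cox2013, §2.A] -/
theorem properEquiv_step_iterate (f : BinQF) : ∀ n : ℕ, f.ProperEquiv (step^[n] f)
  | 0 => ProperEquiv.refl f
  | n + 1 => by
    rw [Function.iterate_succ_apply']
    exact (properEquiv_step_iterate f n).trans (properEquiv_step _)

/-- Steps preserve `IsPosPrim D` (`D < 0`). [cite: Cox2013, §2.A] -/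
theorem isPosPrim_step {D : ℤ} (hD : D < 0) {f : BinQF} (hf : f.IsPosPrim D) : (step f).IsPosPrim D :=
  (properEquiv_step f).isPosPrim hD hf

/-- Iterated steps preserve `IsPosPrim D`. [cite: Cox2013, §2.A] -/
theorem isPosPrim_step_iterate {D : ℤ} (hD : D < 0) {f : BinQF} (hf : f.IsPosPrim D) (n : ℕ) :
    (step^[n] f).IsPosPrim D :=
  (properEquiv_step_iterate f n).isPosPrim hD hf

/-- A normal form that needs no swap is reduced. [cite: Cox2013, §2.A eq. (2.4)] -/
theorem isReduced_of_not_needsSwap {g : BinQF} (ha : 0 < g.a) (h1 : -g.a < g.b) (h2 : g.b ≤ g.a)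
    (hns : ¬ NeedsSwap g) : g.IsReduced := by
  simp only [NeedsSwap, not_or, not_and, not_lt] at hns
  obtain ⟨hca, hsign⟩ := hns
  refine ⟨abs_le.mpr ⟨h1.le, h2⟩, hca, fun h => ?_⟩
  rcases h with h | h
  · -- `|b| = a`: then `b = a ≥ 0`
    rcases abs_eq (ha.le) |>.mp h with h' | h'
    · linarith
    · linarith
  · exact hsign h

/-- **A reduced form is fixed by a step** (for `a > 0`). [cite: Cox2013, §2.A Thm. 2.8] -/
theorem step_eq_self_of_isReduced {f : BinQF} (ha : 0 < f.a) (hr : f.IsReduced) : step f = f := by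
  obtain ⟨hb, hac, hsign⟩ := hr
  obtain ⟨hb1, hb2⟩ := abs_le.mp hb
  have hb1' : -f.a < f.b := by
    rcases hb1.eq_or_lt with h | h
    · -- `b = -a` would force `b ≥ 0`, i.e. `a ≤ 0`
      have : 0 ≤ f.b := hsign (Or.inl (by rw [← h, abs_neg, abs_of_pos ha]))
      linarith
    · exact h
  have hn : normalizeB f = f := normalizeB_eq_self ha hb1' hb2
  have hns : ¬ NeedsSwap f := by
    rintro (h | ⟨h, hb0⟩)
    · linarith
    · linarith [hsign (Or.inr h)]
  rw [step, hn, if_neg hns]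

/-- Iterating steps on a reduced form does nothing. [folklore] -/
theorem step_iterate_eq_self_of_isReduced {f : BinQF} (ha : 0 < f.a) (hr : f.IsReduced) (n : ℕ) :
    step^[n] f = f :=
  Function.iterate_fixed (step_eq_self_of_isReduced ha hr) n

/-- Once some iterate is reduced, all later iterates are (and equal it). [folklore] -/
theorem isReduced_step_iterate_of_le {D : ℤ} (hD : D < 0) {f : BinQF} (hf : f.IsPosPrim D) {n n' : ℕ}
    (h : n ≤ n') (hr : (step^[n] f).IsReduced) : (step^[n'] f).IsReduced := by
  obtain ⟨d, rfl⟩ := Nat.exists_eq_add_of_le h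
  rw [add_comm, Function.iterate_add_apply,
    step_iterate_eq_self_of_isReduced (isPosPrim_step_iterate hD hf n).a_pos hr]
  exact hr

/-! ### Halving while `a² > |D|` -/

/-- **Halving**: for a primitive positive definite `f` with `a² > |D|`, the step swaps and the new
first coefficient is `< a/2` (after normalising, `4ac = b² + |D| ≤ a² + |D| < 2a²`).
[cite: Cox2013, §2.A Thm. 2.8 (proof)] -/
theorem step_a_lt_half {D : ℤ} (hD : D < 0) {f : BinQF} (hf : f.IsPosPrim D) (hbig : -D < f.a ^ 2) :
    2 * (step f).a < f.a := by
  have ha := hf.a_pos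
  set g := normalizeB f with hg
  have hgp : g.IsPosPrim D := (properEquiv_normalizeB f).isPosPrim hD hf
  obtain ⟨hb1, hb2⟩ := normalizeB_b_bounds (f := f) ha
  rw [← hg] at hb1 hb2
  have hga : g.a = f.a := rfl
  have hdisc := hgp.disc_eq
  simp only [disc] at hdisc
  have hbb : g.b ^ 2 ≤ f.a ^ 2 := by rw [← hga]; nlinarith
  have h2c : 2 * g.c < f.a := by nlinarith
  have hswap : NeedsSwap g := Or.inl (by rw [hga]; linarith [BinQF.IsPosPrim.c_pos _ hD hgp])
  have hstep : step f = swapS g := by rw [step, ← hg, if_pos hswap]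
  rw [hstep]
  exact h2c

/-! ### The tail: two steps once `a² ≤ |D|` -/

/-- The shift used after a swap is `j ∈ {−1, 0, 1}`, whence the new last coefficient is at least
the new first one. Precisely: if `g = (a, b, c)` is primitive positive definite of discriminant
`D` with `−a < b ≤ a`, `a² ≤ |D|` and `c ≤ a`, then the normalisation `(c, b₁, c₁)` of the swapped
form `(c, −b, a)` has `c ≤ c₁`. [cite: Cox2013, §2.A Thm. 2.8 (proof)] -/
theorem swap_c_le {D : ℤ} (hD : D < 0) {g : BinQF} (hg : g.IsPosPrim D) (h1 : -g.a < g.b)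
    (h2 : g.b ≤ g.a) (hsmall : g.a ^ 2 ≤ -D) (hca : g.c ≤ g.a) :
    (normalizeB (swapS g)).a ≤ (normalizeB (swapS g)).c := by
  have ha := hg.a_pos
  have hc := BinQF.IsPosPrim.c_pos _ hD hg
  have hdisc := hg.disc_eq
  simp only [disc] at hdisc
  set j := normShift (swapS g) with hj
  have hb₁ : (normalizeB (swapS g)).b = -g.b + 2 * g.c * j := by rw [hj]; rfl
  have hc₁ : (normalizeB (swapS g)).c = g.c * j ^ 2 + -g.b * j + g.a := by rw [hj]; rfl
  have ha₁ : (normalizeB (swapS g)).a = g.c := rfl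
  obtain ⟨hl, hu⟩ := normalizeB_b_bounds (f := swapS g) (show 0 < (swapS g).a from hc)
  rw [hb₁] at hl hu
  change -g.c < -g.b + 2 * g.c * j at hl
  change -g.b + 2 * g.c * j ≤ g.c at hu
  rw [ha₁, hc₁]
  -- `|j| ≤ 1`
  have hj1 : -1 ≤ j ∧ j ≤ 1 := by
    by_contra hcon
    rw [not_and_or, not_le, not_le] at hcon
    have hbb : g.b ^ 2 ≤ g.a ^ 2 := by nlinarith
    rcases hcon with hlt | hgt
    · -- `j ≤ -2`: `b ≤ 2cj + c ≤ -3c`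
      have : g.b ≤ -3 * g.c := by nlinarith
      nlinarith [sq_nonneg (g.a - 2 * g.c)]
    · -- `j ≥ 2`: `b > 2cj - c ≥ 3c`
      have : 3 * g.c < g.b := by nlinarith
      nlinarith [sq_nonneg (g.a - 2 * g.c)]
  obtain ⟨hjl, hju⟩ := hj1
  interval_cases j
  · nlinarith
  · nlinarith
  · nlinarith

/-- **Two steps reduce once `a² ≤ |D|`.** [cite: Cox2013, §2.A Thm. 2.8 (proof)] -/
theorem isReduced_step_step {D : ℤ} (hD : D < 0) {f : BinQF} (hf : f.IsPosPrim D)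
    (hsmall : f.a ^ 2 ≤ -D) : (step (step f)).IsReduced := by
  have ha := hf.a_pos
  set g := normalizeB f with hg
  have hgp : g.IsPosPrim D := (properEquiv_normalizeB f).isPosPrim hD hf
  obtain ⟨hb1, hb2⟩ := normalizeB_b_bounds (f := f) ha
  rw [← hg] at hb1 hb2
  have hga : g.a = f.a := rfl
  rw [← hga] at hb1 hb2 hsmall
  by_cases hns : NeedsSwap g
  · have hstep : step f = swapS g := by rw [step, ← hg, if_pos hns]
    rw [hstep]
    rcases hns with hlt | ⟨heq, hneg⟩
    · -- genuine swap: after normalising, `c₁ ≥ c`, so at most a sign swap remains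
      have hle := swap_c_le hD hgp hb1 hb2 hsmall hlt.le
      set g₁ := normalizeB (swapS g) with hg₁
      have hg₁p : g₁.IsPosPrim D :=
        (properEquiv_normalizeB _).isPosPrim hD (g.properEquiv_S.isPosPrim hD hgp)
      have hg₁a : 0 < g₁.a := hg₁p.a_pos
      obtain ⟨hl₁, hu₁⟩ := normalizeB_b_bounds (f := swapS g) (show 0 < (swapS g).a from BinQF.IsPosPrim.c_pos _ hD hgp)
      rw [← hg₁] at hl₁ hu₁
      change -g₁.a < g₁.b at hl₁
      change g₁.b ≤ g₁.a at hu₁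
      by_cases hns₁ : NeedsSwap g₁
      · have hstep₁ : step (swapS g) = swapS g₁ := by rw [step, ← hg₁, if_pos hns₁]
        rw [hstep₁]
        -- only the sign case is possible
        rcases hns₁ with hlt₁ | ⟨heq₁, hneg₁⟩
        · exact absurd hlt₁ (not_lt.mpr hle)
        · refine ⟨?_, heq₁.ge, fun _ => ?_⟩
          · show |(-g₁.b)| ≤ g₁.c
            rw [abs_neg, ← heq₁]; exact abs_le.mpr ⟨hl₁.le, hu₁⟩
          · show 0 ≤ -g₁.b
            linarith
      · have hstep₁ : step (swapS g) = g₁ := by rw [step, ← hg₁, if_neg hns₁]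
        rw [hstep₁]
        exact isReduced_of_not_needsSwap hg₁a hl₁ hu₁ hns₁
    · -- sign swap at `a = c`: `(a, -b, a)` with `0 < -b < a` is reduced
      have hr : (swapS g).IsReduced := by
        refine ⟨?_, heq.ge, fun _ => ?_⟩
        · show |(-g.b)| ≤ g.c
          rw [abs_neg, ← heq]; exact abs_le.mpr ⟨hb1.le, hb2⟩
        · show 0 ≤ -g.b
          linarith
      rw [step_eq_self_of_isReduced (show 0 < (swapS g).a from BinQF.IsPosPrim.c_pos _ hD hgp) hr]
      exact hr
  · have hstep : step f = g := by rw [step, ← hg, if_neg hns]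
    have hr : g.IsReduced := isReduced_of_not_needsSwap hgp.a_pos hb1 hb2 hns
    rw [hstep, step_eq_self_of_isReduced hgp.a_pos hr]
    exact hr

/-! ### The algorithm and its correctness -/

/-- A negative discriminant of a positive definite form is `≤ −3` (`D ≡ 0, 1 (mod 4)`). [folklore] -/
theorem three_le_neg_disc {D : ℤ} (hD : D < 0) {f : BinQF} (hf : f.IsPosPrim D) : 3 ≤ -D := by
  rcases hf.emod_four with h | h <;> omega

/-- **Logarithmically many steps reduce**: if `a ≤ 2^n` then `step^[n + 3] f` is reduced (halving
`⌊log₂ a⌋ + 1` times brings `a² ≤ |D|`, then two more steps). [cite: Cox2013, §2.A Thm. 2.8] -/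
theorem isReduced_step_iterate {D : ℤ} (hD : D < 0) :
    ∀ (n : ℕ) (f : BinQF), f.IsPosPrim D → f.a ≤ 2 ^ n → (step^[n + 3] f).IsReduced
  | 0, f, hf, hn => by
    have ha := hf.a_pos
    have ha1 : f.a = 1 := by
      have : (2 : ℤ) ^ 0 = 1 := pow_zero 2
      omega
    have hsmall : f.a ^ 2 ≤ -D := by
      rw [ha1, one_pow]
      linarith [three_le_neg_disc hD hf]
    have h2 : (step^[2] f).IsReduced := isReduced_step_step hD hf hsmall
    exact isReduced_step_iterate_of_le hD hf (by norm_num) h2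
  | n + 1, f, hf, hn => by
    by_cases hsmall : f.a ^ 2 ≤ -D
    · have h2 : (step^[2] f).IsReduced := isReduced_step_step hD hf hsmall
      exact isReduced_step_iterate_of_le hD hf (by omega) h2
    · push Not at hsmall
      have hhalf := step_a_lt_half hD hf hsmall
      have hf' := isPosPrim_step hD hf
      have hn' : (step f).a ≤ 2 ^ n := by
        have : (2 : ℤ) ^ (n + 1) = 2 * 2 ^ n := by ring
        omega
      have := isReduced_step_iterate hD n (step f) hf' hn'
      rwa [← Function.iterate_succ_apply, show (n + 3).succ = n + 1 + 3 by omega] at this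

/-- The number of steps used: `⌊log₂ a⌋ + 4`. [folklore] -/
def reduceSteps (f : BinQF) : ℕ := Nat.log 2 f.a.toNat + 4

/-- **The reduction algorithm**: `⌊log₂ a⌋ + 4` Gauss steps. [cite: Cox2013, §2.A Thm. 2.8] -/
def reduce (f : BinQF) : BinQF := step^[reduceSteps f] f

/-- `reduce f` is properly equivalent to `f`. [cite: Cox2013, §2.A Thm. 2.8] -/
theorem properEquiv_reduce (f : BinQF) : f.ProperEquiv (reduce f) := properEquiv_step_iterate f _

/-- `reduce` preserves `IsPosPrim D`. [cite: Cox2013, §2.A] -/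
theorem isPosPrim_reduce {D : ℤ} (hD : D < 0) {f : BinQF} (hf : f.IsPosPrim D) : (reduce f).IsPosPrim D :=
  isPosPrim_step_iterate hD hf _

/-- **`reduce f` is reduced** for every primitive positive definite `f` of negative discriminant.
[cite: Cox2013, §2.A Thm. 2.8] -/
theorem isReduced_reduce {D : ℤ} (hD : D < 0) {f : BinQF} (hf : f.IsPosPrim D) : (reduce f).IsReduced := by
  have ha := hf.a_pos
  have hn : f.a ≤ 2 ^ (Nat.log 2 f.a.toNat + 1) := by
    have h := Nat.lt_pow_succ_log_self (b := 2) Nat.one_lt_two f.a.toNat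
    have h' : (f.a.toNat : ℤ) < 2 ^ (Nat.log 2 f.a.toNat + 1) := by exact_mod_cast h
    rw [Int.toNat_of_nonneg ha.le] at h'
    exact h'.le
  have := isReduced_step_iterate hD _ f hf hn
  rw [reduce, reduceSteps]
  exact this

/-- The output, as a triple, lies in `reducedForms D`. [cite: Cox2013, §2.A Thm. 2.13] -/
theorem reduce_mem_reducedForms {D : ℤ} (hD : D < 0) {f : BinQF} (hf : f.IsPosPrim D) :
    ((reduce f).a, (reduce f).b, (reduce f).c) ∈ reducedForms D :=
  mem_reducedForms_of_isPosPrim_of_isReduced hD (isPosPrim_reduce hD hf) (isReduced_reduce hD hf)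

/-- **`reduce` is a complete invariant of the proper class**: for primitive positive definite
forms of discriminant `D < 0`, `reduce f = reduce g ↔ f ∼ g` (uniqueness of the reduced form in a
class, the tree's `BinQF.isReduced_unique`). [cite: Cox2013, §2.A Thm. 2.8] -/
theorem reduce_eq_iff_properEquiv {D : ℤ} (hD : D < 0) {f g : BinQF} (hf : f.IsPosPrim D)
    (hg : g.IsPosPrim D) : reduce f = reduce g ↔ f.ProperEquiv g := by
  constructor
  · intro h
    exact (properEquiv_reduce f).trans (h ▸ (properEquiv_reduce g).symm)
  · intro h
    exact isReduced_unique hD hf (properEquiv_reduce f) (h.trans (properEquiv_reduce g))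
      (isReduced_reduce hD hf) (isReduced_reduce hD hg)

/-- A reduced form is its own reduction. [cite: Cox2013, §2.A Thm. 2.8] -/
theorem reduce_eq_self_of_isReduced {f : BinQF} (ha : 0 < f.a) (hr : f.IsReduced) : reduce f = f :=
  step_iterate_eq_self_of_isReduced ha hr _

end Reduction

end Literature.Computability.Cryptography.Hallgren2005
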